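import Mathlib
import Summits.Ventures.HodgeRepro.Tier4.Common.LocalTorusCompactConj
import Summits.Ventures.HodgeRepro.Tier4.Common.TorusInfCompactConj
import Summits.Ventures.HodgeRepro.Tier4.Common.TestProjectorVanishing
import Summits.Ventures.HodgeRepro.Tier4.Common.CompactHaarProbability
import Summits.Ventures.HodgeRepro.Tier4.Common.RowTorus
import Summits.Ventures.HodgeRepro.Tier4.Line4.ProjPlane
import Summits.Ventures.HodgeRepro.Tier4.Line4.ProjDataSeesaw
import Summits.Ventures.HodgeRepro.Tier4.Line4.KTypeOfPeriodClosed
import Summits.Ventures.HodgeRepro.Tier4.Line4.KTypeOfPeriodTransported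

/-!
# Tier4/Line4/KTypeOfPeriodSeesaw — C-L4-KTYPE-SEESAW: BOTH `K`-type conjuncts of admissibility on the wall's plane, by name

Blind re-derivation cell `pub-hodge-repro`, Tier 4 «prove the step» (README §9–§10), seat t4-L4-p1 (prover, LINE L4,
gen 4; self-cut S14781 continuing plan-4 g3's C-L4-KTYPE / C-L4-WEIGHTS designs S14010 / S14688).  Tree path
`lean/Summits/Ventures/HodgeRepro/Tier4/Line4/KTypeOfPeriodSeesaw.lean`.  Mathlib-level; no literature.

WHAT IS PROVED, on L4-p2's `seesawOf q a g g' hgg' hg'g hgΩ` (ProjDataSeesaw) = the skeleton's `seesawPlane` (L4 v0.30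
L506–L510) = `(PlaneData.mixedRow q (a 0) (a 2)).withTransportedTorus g g' hgg' hg'g hgΩ`:
* `hasKTypeAt_of_period_ne_zero_seesaw` — the `T`-side `K`-type `(e₊ w, e₋ w)` of `span ℂ U` from a non-zero `T`-period
  (`KTypeOfPeriodTransported.hasKTypeAt_of_period_ne_zero_mixedRow_transported` at `hW := rfl`);
* `torusT'_seesaw_comm` — the transported torus `T′ = g T(mixedRow q a₁ a₃) g⁻¹` is COMMUTATIVE (typer-2's
  `torusT'_withTransportedTorus_conj` conjugates each element into the row torus `torusT (ofLinesRow q (a 1) (a 3) (-1))`,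
  which is commutative by `torusT_ofLinesRow_comm`; conjugating back), whence `isMulRightInvariant_torusT'_seesaw`: a
  left-invariant measure on `T′` is right-invariant;
* `hasKTypeAt'_of_period_ne_zero_seesaw` — the `T′`-side `K`-type `(e₊′ w, e₋′ w)` of `span ℂ U` from a non-zero
  `T′`-period: `KTypeOfPeriodClosed.hasKTypeAt'_of_period_ne_zero_span` with every display bound by name —
  `[CompactSpace (localTorusAt' _ w)]` := typer-2's `compactSpace_localTorusAt'_seesaw` (LocalTorusCompactConj), `ν` :=
  `haarProb`, `hχ` / `hu'` := `weightChar'_mul_of_conj` / `norm_weightChar'_eq_one_of_conj` (TestProjectorVanishing) on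
  `localTorusAt'_withTransportedTorus_conj` (ProjPlane), `hχc` := L4-p2's `continuous_weightChar'_localTorusAt'`
  (ProjDataSeesaw), `[R.μT'.IsMulRightInvariant]` := `isMulRightInvariant_torusT'_seesaw`.
What stays DISPLAYED is the wall's own data (v0.30 `mixed_two_torus_W3`): `a i ≠ 0`, the similitude `lam`/`hiso`, the
real CM place `w`, the unitary continuous characters and their exponent compatibility (`ChiMatchesAt` / `ChiMatchesAt'`
at `w`), the closed invariant subspace `U`, `f ∈ span ℂ U`, and the non-vanishing of the period.

Nothing here says anything about the status of the Hodge conjecture for CM abelian varieties, which is NOT proved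
(HC_CM is NOT proved by anyone in this repository).
-/

set_option autoImplicit false

noncomputable section

namespace Summit.Ventures.HodgeRepro.Tier4.Line4

open Summit.Ventures.HodgeRepro.Tier4.Common Summit.Ventures.HodgeRepro.Tier4.Line1 MeasureTheory NumberField Matrix
open scoped ComplexConjugate

section Comm

variable {k : Type} [Field k] [NumberField k] (q : QuadData k) (a : Fin 4 → k)
  (g g' : Matrix (Fin 4) (Fin 4) k) (hgg' : g * g' = 1) (hg'g : g' * g = 1)
  (hgΩ : g * (PlaneData.mixedRow q (a 0) (a 2)).Ω = (PlaneData.mixedRow q (a 0) (a 2)).Ω * g)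

/-- **The transported torus `T′` of the seesaw plane is commutative**: its elements are the conjugates `g κ′ g⁻¹` of the
elements `κ′` of the commutative row torus `torusT (ofLinesRow q (a 1) (a 3) (-1))`. -/
theorem torusT'_seesaw_comm (lam : k) (hlam : lam ≠ 0)
    (hiso : g * (PlaneData.mixedRow q (a 1) (a 3)).B * gᵀ = lam • (PlaneData.mixedRow q (a 0) (a 2)).B)
    (ha1 : a 1 ≠ 0) (ha3 : a 3 ≠ 0) (s t : GA (seesawOf q a g g' hgg' hg'g hgΩ))
    (hs : s ∈ torusT' (seesawOf q a g g' hgg' hg'g hgΩ)) (ht : t ∈ torusT' (seesawOf q a g g' hgg' hg'g hgΩ)) :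
    s * t = t * s := by
  have hA : adMat k g * adMat k g' = 1 := adMat_mul_adMat_eq_one g g' hgg'
  obtain ⟨s', hs', hsm⟩ := torusT'_withTransportedTorus_conj q a g g' hgg' hg'g hgΩ lam hlam hiso s hs
  obtain ⟨t', ht', htm⟩ := torusT'_withTransportedTorus_conj q a g g' hgg' hg'g hgΩ lam hlam hiso t ht
  -- conjugating back: `mat s = g (mat s') g′`
  have hback : ∀ (x : GA (seesawOf q a g g' hgg' hg'g hgΩ)) (x' : GA (PlaneData.ofLinesRow q (a 1) (a 3) (-1))),
      GA.mat (PlaneData.ofLinesRow q (a 1) (a 3) (-1)) x' = adMat k g' * GA.mat _ x * adMat k g →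
      GA.mat _ x = adMat k g * GA.mat (PlaneData.ofLinesRow q (a 1) (a 3) (-1)) x' * adMat k g' := by
    intro x x' h
    rw [h]
    calc GA.mat _ x = (adMat k g * adMat k g') * GA.mat _ x * (adMat k g * adMat k g') := by
          rw [hA, Matrix.one_mul, Matrix.mul_one]
      _ = adMat k g * (adMat k g' * GA.mat _ x * adMat k g) * adMat k g' := by
          simp only [Matrix.mul_assoc]
  have hcomm : s' * t' = t' * s' :=
    torusT_ofLinesRow_comm q (a 1) (a 3) (-1) ha1 ha3 (neg_ne_zero.2 one_ne_zero) s' t' hs' ht'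
  have hcommM : GA.mat _ s' * GA.mat _ t' = GA.mat _ t' * GA.mat _ s' := by
    have h := congrArg (GA.mat (PlaneData.ofLinesRow q (a 1) (a 3) (-1))) hcomm
    rwa [GA.mat_mul, GA.mat_mul] at h
  apply Subtype.ext
  apply Units.ext
  change GA.mat _ s * GA.mat _ t = GA.mat _ t * GA.mat _ s
  rw [hback s s' hsm, hback t t' htm]
  calc adMat k g * GA.mat _ s' * adMat k g' * (adMat k g * GA.mat _ t' * adMat k g')
      = adMat k g * (GA.mat _ s' * GA.mat _ t') * adMat k g' := by
        calc adMat k g * GA.mat _ s' * adMat k g' * (adMat k g * GA.mat _ t' * adMat k g')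
            = adMat k g * GA.mat _ s' * (adMat k g' * adMat k g) * GA.mat _ t' * adMat k g' := by
              simp only [Matrix.mul_assoc]
          _ = adMat k g * (GA.mat _ s' * GA.mat _ t') * adMat k g' := by
              rw [adMat_mul_adMat_eq_one g' g hg'g, Matrix.mul_one]
              simp only [Matrix.mul_assoc]
    _ = adMat k g * (GA.mat _ t' * GA.mat _ s') * adMat k g' := by rw [hcommM]
    _ = adMat k g * GA.mat _ t' * adMat k g' * (adMat k g * GA.mat _ s' * adMat k g') := by
        calc adMat k g * (GA.mat _ t' * GA.mat _ s') * adMat k g'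
            = adMat k g * GA.mat _ t' * (adMat k g' * adMat k g) * GA.mat _ s' * adMat k g' := by
              rw [adMat_mul_adMat_eq_one g' g hg'g, Matrix.mul_one]
              simp only [Matrix.mul_assoc]
          _ = adMat k g * GA.mat _ t' * adMat k g' * (adMat k g * GA.mat _ s' * adMat k g') := by
              simp only [Matrix.mul_assoc]

/-- **A left-invariant measure on the transported torus `T′` of the seesaw plane is right-invariant.** -/
theorem isMulRightInvariant_torusT'_seesaw (lam : k) (hlam : lam ≠ 0)
    (hiso : g * (PlaneData.mixedRow q (a 1) (a 3)).B * gᵀ = lam • (PlaneData.mixedRow q (a 0) (a 2)).B)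
    (ha1 : a 1 ≠ 0) (ha3 : a 3 ≠ 0) [MeasurableSpace (torusT' (seesawOf q a g g' hgg' hg'g hgΩ))]
    (μT' : Measure (torusT' (seesawOf q a g g' hgg' hg'g hgΩ))) [μT'.IsMulLeftInvariant] :
    μT'.IsMulRightInvariant :=
  isMulRightInvariant_of_forall_comm μT' fun s t =>
    Subtype.ext (torusT'_seesaw_comm q a g g' hgg' hg'g hgΩ lam hlam hiso ha1 ha3 s.1 t.1 s.2 t.2)

end Comm

section KType

variable {k : Type} [Field k] [NumberField k] (q : QuadData k) (a : Fin 4 → k)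
  (g g' : Matrix (Fin 4) (Fin 4) k) (hgg' : g * g' = 1) (hg'g : g' * g = 1)
  (hgΩ : g * (PlaneData.mixedRow q (a 0) (a 2)).Ω = (PlaneData.mixedRow q (a 0) (a 2)).Ω * g)
  [MeasurableSpace (GA (seesawOf q a g g' hgg' hg'g hgΩ))] [BorelSpace (GA (seesawOf q a g g' hgg' hg'g hgΩ))]
  (R : RTFData (seesawOf q a g g' hgg' hg'g hgΩ)) (μ : Measure (GA (seesawOf q a g g' hgg' hg'g hgΩ)))
  [μ.IsHaarMeasure] [R.μT.IsHaarMeasure] [R.μT'.IsHaarMeasure] (DG : Set (GA (seesawOf q a g g' hgg' hg'g hgΩ)))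
  (fdG : IsFundamentalDomain (rationalPoints (seesawOf q a g g' hgg' hg'g hgΩ)) DG μ) (compG : IsCompact (closure DG))
  (compT : IsCompact (closure R.DT)) (compT' : IsCompact (closure R.DT'))

/-- **The `T`-side `K`-type on the seesaw plane** (C-L4-KTYPE (4) of admissibility, by name): a non-zero `T`-period of
`f ∈ span ℂ U` against the unitary continuous `R.chi` matching `(e₊ w, e₋ w)` at the real CM place `w` gives
`HasKTypeAt (seesawOf …) q w (e₊ w) (e₋ w) (span ℂ U)`. -/
theorem hasKTypeAt_of_period_ne_zero_seesaw (ha0 : a 0 ≠ 0) (ha2 : a 2 ≠ 0) {w : InfinitePlace k}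
    (hw : w.IsReal) (hcm : IsCMAt q w) (eP eM : InfinitePlace k → ℤ)
    (hu : ∀ t, ‖R.chi t‖ = 1) (hc : Continuous R.chi)
    (hmatch : ChiMatchesAt (seesawOf q a g g' hgg' hg'g hgΩ) q w (eP w) (eM w) R.chi)
    {U : Set (GA (seesawOf q a g g' hgg' hg'g hgΩ) → ℂ)}
    (hU : (Setting.ofAdelicData (seesawOf q a g g' hgg' hg'g hgΩ) R μ DG fdG compG compT compT').IsInvariantSubspace U)
    (hcl : IsClosedSub (Setting.ofAdelicData (seesawOf q a g g' hgg' hg'g hgΩ) R μ DG fdG compG compT compT') U)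
    {f : GA (seesawOf q a g g' hgg' hg'g hgΩ) → ℂ} (hf : f ∈ Submodule.span ℂ U)
    (hP : periodLin (seesawOf q a g g' hgg' hg'g hgΩ) R.μT R.DT R.chi
      (restrictTo (seesawOf q a g g' hgg' hg'g hgΩ) (torusT (seesawOf q a g g' hgg' hg'g hgΩ)) f) ≠ 0) :
    HasKTypeAt (seesawOf q a g g' hgg' hg'g hgΩ) q w (eP w) (eM w) (Submodule.span ℂ U) :=
  hasKTypeAt_of_period_ne_zero_mixedRow_transported q (a 0) (a 2) g g' hgg' hg'g hgΩ (seesawOf q a g g' hgg' hg'g hgΩ)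
    R μ DG fdG compG compT compT' rfl ha0 ha2 hw hcm eP eM hu hc hmatch hU hcl hf hP

/-- **The `T′`-side `K`-type on the seesaw plane** (C-L4-KTYPE (6) of admissibility, by name): a non-zero `T′`-period of
`f ∈ span ℂ U` against the unitary continuous `R.chi'` matching `(e₊′ w, e₋′ w)` at the real CM place `w` gives
`HasKTypeAt' (seesawOf …) q w g g' (e₊′ w) (e₋′ w) (span ℂ U)` — under the wall's similitude display (`lam`, `hiso`) and
`a 1 ≠ 0`, `a 3 ≠ 0` (the compactness of the transported local torus and the weight identities on it). -/
theorem hasKTypeAt'_of_period_ne_zero_seesaw (lam : k) (hlam : lam ≠ 0)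
    (hiso : g * (PlaneData.mixedRow q (a 1) (a 3)).B * gᵀ = lam • (PlaneData.mixedRow q (a 0) (a 2)).B)
    (ha1 : a 1 ≠ 0) (ha3 : a 3 ≠ 0) {w : InfinitePlace k} (hw : w.IsReal) (hcm : IsCMAt q w)
    (eP' eM' : InfinitePlace k → ℤ) (hu : ∀ t, ‖R.chi' t‖ = 1) (hc : Continuous R.chi')
    (hmatch : ChiMatchesAt' (seesawOf q a g g' hgg' hg'g hgΩ) q w g g' (eP' w) (eM' w) R.chi')
    {U : Set (GA (seesawOf q a g g' hgg' hg'g hgΩ) → ℂ)}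
    (hU : (Setting.ofAdelicData (seesawOf q a g g' hgg' hg'g hgΩ) R μ DG fdG compG compT compT').IsInvariantSubspace U)
    (hcl : IsClosedSub (Setting.ofAdelicData (seesawOf q a g g' hgg' hg'g hgΩ) R μ DG fdG compG compT compT') U)
    {f : GA (seesawOf q a g g' hgg' hg'g hgΩ) → ℂ} (hf : f ∈ Submodule.span ℂ U)
    (hP : periodLin (seesawOf q a g g' hgg' hg'g hgΩ) R.μT' R.DT' R.chi'
      (restrictTo (seesawOf q a g g' hgg' hg'g hgΩ) (torusT' (seesawOf q a g g' hgg' hg'g hgΩ)) f) ≠ 0) :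
    HasKTypeAt' (seesawOf q a g g' hgg' hg'g hgΩ) q w g g' (eP' w) (eM' w) (Submodule.span ℂ U) := by
  have hconj := localTorusAt'_withTransportedTorus_conj q a g g' hgg' hg'g hgΩ lam hlam hiso w
  have hε : (-1 : k) ≠ 0 := neg_ne_zero.2 one_ne_zero
  haveI : R.μT'.IsMulRightInvariant :=
    isMulRightInvariant_torusT'_seesaw q a g g' hgg' hg'g hgΩ lam hlam hiso ha1 ha3 R.μT'
  haveI : CompactSpace (localTorusAt' (seesawOf q a g g' hgg' hg'g hgΩ) w) :=
    compactSpace_localTorusAt'_seesaw q a g g' hgg' hg'g hgΩ lam hlam hiso ha1 ha3 hw hcm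
  haveI := isHaarMeasure_haarProb (localTorusAt' (seesawOf q a g g' hgg' hg'g hgΩ) w)
  haveI := isProbabilityMeasure_haarProb (localTorusAt' (seesawOf q a g g' hgg' hg'g hgΩ) w)
  have hnorm : ∀ κ ∈ localTorusAt' (seesawOf q a g g' hgg' hg'g hgΩ) w, ∀ j : Fin 2,
      ‖weightAt' (seesawOf q a g g' hgg' hg'g hgΩ) q w g g' j κ‖ = 1 := fun κ hκ j =>
    norm_weightAt'_eq_one_of_conj q (a 1) (a 3) (-1) w ha1 ha3 hε hw hcm _ g g' w hconj j κ hκ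
  exact hasKTypeAt'_of_period_ne_zero_span (seesawOf q a g g' hgg' hg'g hgΩ) R μ DG fdG compG compT compT' w q eP' eM'
    g g' (haarProb (localTorusAt' (seesawOf q a g g' hgg' hg'g hgΩ) w)) hu hc
    (weightChar'_mul_of_conj q (a 1) (a 3) (-1) w ha1 ha3 hε hw hcm _ g g' (adMat_mul_adMat_eq_one g g' hgg') w hconj
      (eP' w) (eM' w))
    (continuous_weightChar'_localTorusAt' _ q g g' eP' eM' w hnorm)
    (fun κ => norm_weightChar'_eq_one_of_conj q (a 1) (a 3) (-1) w ha1 ha3 hε hw hcm _ g g' w hconj (eP' w) (eM' w)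
      κ κ.2)
    hmatch hU hcl hf hP

end KType

end Summit.Ventures.HodgeRepro.Tier4.Line4

end
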